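import Summits.KontsevichZagierPeriods.KontsevichZagierPeriods.Theorems.RootDecompQuadraticDescentDarkPairsEleven
import Literature.NumberTheory.Transcendental.KZCubeRationalMoves
import HarnessLib
import Literature.NumberTheory.Transcendental.SemialgebraicVolume
import Summits.KontsevichZagierPeriods.KontsevichZagierPeriods.Theorems.RootDecompQuadraticDescentPair18HomotopyP31

/-! # `RootDecompQuadraticDescentPair18HomotopyEulerP1` — part 1/2 of the mechanical ≤400-line split of `Euler_landing.lean` (sha256 d960158e9d9003f9…)
Source: decomp-kz lens-6 g10 `Pair18HomotopyEuler.lean` (file #3; HOME/decomp-kz-lens-6/g10/, sha256 6270564a…; critic g5-19 CLEARED 20:2xZ «census pair #18 = THEOREM, no hypothesis left»): hEuler_holds : 3•[Ax0] − 2•[B11] ∈ KZ.relations — Euler's ζ(2) = π²/6 by regular moves (ϑ-family homotopy cell on □³ + Möbius/reflection/swap/squaring covs); landed by census-1 g9 over the landed file #1 (…Pair18HomotopyP01–P31): copied prelude dropped, Th7_eq/h7q renamed, pins removed.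
Split by census-1 g9 `gen/splitlean.py`: scopes re-opened with their `open`/`variable`/`set_option` context; mathematics and declaration order unchanged. -/

/-!
# Pair18HomotopyEuler — companion file #3 of `Pair18Homotopy.lean` (decomp-kz-lens-6, gen 10)

`Pair18Homotopy.lean` (v14, file #1) proves
`pair18_g8strips_of_grid : hEuler → hGrid → hAng4 → (g8 strips form of census row #18)` and
`Pair18HomotopyAng.lean` (v13, file #2) proves `hAng4_holds`, `hTh7_holds : [Th7] ≡ [W₇|□]`,
`hB17_holds : [B17] ≡ [W₇|[0,1/7]²]`.  Neither file can grow (farm source limit ≈ 512 KiB) and neither is a tree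
module yet, so this file continues IN THE SAME NAMESPACE over a prelude of definitions copied VERBATIM from
v14 / v13 (marked `COPIED PRELUDE`; dropped when the files are split into tree modules at landing).

## What this file decides (0 sorry, std axioms)

**`hEuler_holds : 3•[Ax0] − 2•[B11] ∈ KZ.relations`** — Euler's `ζ(2) = π²/6` as a KZ-relation
(`[Ax0] = π²/24`, `[B11] = [Bbox 1] = arctan² 1 = π²/16`), by REGULAR moves only (no singular integrand, no
limiting process): the one-parameter family of boxes

  `g(t,s;q) = −((1+st) − q²(1−st)) / ((1+st)² + q²(1−st)²)`,  `q = cot(ϑ/2) ∈ [0,1]`,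

interpolates `g|_{q=0} = −1/(1+st)` (`−[U1] = −π²/12`) and `g|_{q=1} = −st/(1+s²t²)` (`−[Q1] = −π²/48`), and
`∂_q g = 4q(1−s²t²)/h² = ∂_s P̃` with the REGULAR primitive `P̃ = 4qs/((1+q²)h)`, `P̃|_{s=0} = 0`,
`P̃|_{s=1} = R1 := 4q/((1+q²)((1+t)²+q²(1−t)²))`.  Green on the cube (`telescope₁`) gives
`[U1] − [Q1] ≡ [R1]`; the Möbius involution `t = (1−w)/(1+w)` (`rel_moeb` after a reflection) carries `R1 dt`
to `2q dw/((1+q²)(1+q²w²))`, i.e. `[R1] ≡ [Bq 1] ≡ [Bbox 1] = [B11]` (`Bq_Bbox`), and `[Ax0] ≡ 2•[Q1]`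
(`x ↦ x²` in the swapped variable).  With `U1_Ax0 : [U1] ≡ 2•[Ax0]` (v14):
`3•[Ax0] − 2•[B11] = 2•([U1]−[Q1]−[R1]) + 2•([R1]−[B11]) − 2•([U1]−2•[Ax0]) − ([Ax0]−2•[Q1])`.

(Classically: `∫₀¹∫₀¹ ((1+st) − q²(1−st)) ds dt/((1+st)²+q²(1−st)²)` is the `ϑ`-family joining `ζ(2)/2`
at `ϑ = π` to `ζ(2)/8` at `ϑ = π/2`, `q = cot(ϑ/2)`; its `q`-derivative is exact in `s` with an algebraic
primitive — the mechanism behind Calabi's proof, run here without Calabi's singular change of variables.)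
-/

set_option linter.unusedSimpArgs false

noncomputable section

open _root_.Set MvPolynomial

namespace Summit.KontsevichZagierPeriods.RootDecompQuadraticDescent.Pair18Homotopy

open Literature.NumberTheory.Transcendental
open Literature.NumberTheory.Transcendental.KZ (RFun cube)
open Summit.KontsevichZagierPeriods.RootDecompQuadraticDescent.DarkPairs (rel_reflect_rep rel_double)

-- landed-private prelude lemmas re-declared for this module (gate dedup twins of tree lemmas; privatised again at landing):
/-- Auxiliary step `cube2` (§0): cube2. [bookkeeping] -/
private theorem cube2 {x : Fin 2 → ℝ} (hx : x ∈ KZ.cube 2) : (0 ≤ x 0 ∧ x 0 ≤ 1) ∧ (0 ≤ x 1 ∧ x 1 ≤ 1) := ⟨hx 0, hx 1⟩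

/-- Auxiliary step `ins2_0` (§0): ins2 0. [bookkeeping] -/
private theorem ins2_0 (c : ℝ) (x : Fin 2 → ℝ) : (Fin.insertNth (2 : Fin 3) c x : Fin 3 → ℝ) 0 = x 0 := rfl

/-- Auxiliary step `ins2_1` (§0): ins2 1. [bookkeeping] -/
private theorem ins2_1 (c : ℝ) (x : Fin 2 → ℝ) : (Fin.insertNth (2 : Fin 3) c x : Fin 3 → ℝ) 1 = x 1 := rfl

/-- Auxiliary step `ins2_2` (§0): ins2 2. [bookkeeping] -/
private theorem ins2_2 (c : ℝ) (x : Fin 2 → ℝ) : (Fin.insertNth (2 : Fin 3) c x : Fin 3 → ℝ) 2 = c := by simp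

/-- Auxiliary step `ins1_0` (§0): ins1 0. [bookkeeping] -/
private theorem ins1_0 (c : ℝ) (x : Fin 2 → ℝ) : (Fin.insertNth (1 : Fin 3) c x : Fin 3 → ℝ) 0 = x 0 := rfl

/-- Auxiliary step `ins1_2` (§0): ins1 2. [bookkeeping] -/
private theorem ins1_2 (c : ℝ) (x : Fin 2 → ℝ) : (Fin.insertNth (1 : Fin 3) c x : Fin 3 → ℝ) 2 = x 1 := rfl

/-- Auxiliary step `ins1_1` (§0): ins1 1. [bookkeeping] -/
private theorem ins1_1 (c : ℝ) (x : Fin 2 → ℝ) : (Fin.insertNth (1 : Fin 3) c x : Fin 3 → ℝ) 1 = c := by simp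

/-- Auxiliary step `vec2_0` (§2b): vec2 0. [bookkeeping] -/
private theorem vec2_0 (a b : ℝ) : (![a, b] : Fin 2 → ℝ) 0 = a := rfl

/-- Auxiliary step `vec2_1` (§2b): vec2 1. [bookkeeping] -/
private theorem vec2_1 (a b : ℝ) : (![a, b] : Fin 2 → ℝ) 1 = b := rfl

-- ===== COPIED PRELUDE (verbatim from Pair18Homotopy.lean v14 [P1] / Pair18HomotopyAng.lean v13 [P2]; not to be spliced) =====
-- [P1 l.138–172]
/-! ## §0 Generic: boundary terms and telescoping on the cube (verbatim from gen-8 `TelescopeCube.lean`) -/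

-- [P1 l.174–190]

-- [P1 l.206, 240–244, 262–263]

-- [P1 l.2123, 2134–2138, 2195–2198]

-- [P1 l.570–585]

section Fold
open Literature.ModelTheory.ExponentialFields (IsSemialgebraic isSemialgebraic_setOf_eval_le
  isSemialgebraic_setOf_eval_pos isSemialgebraic_setOf_eval_nonneg isSemialgebraic_setOf_eval_eq_zero)

-- [P2 l.88–92]

-- [P1 l.1244–1323]

-- [P1 l.2218–2237]

-- [P1 l.1480–1582]

-- [P2 l.4542–4607]

-- [P2 l.173–194]
-- (verbatim from Pair18Homotopy.lean v14: Th7 l.3279–3287, Bbox l.4753–4762, B17 l.5042–5043)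

-- [P2 l.4638–4680]

/-- Auxiliary step `h7qE` (§0): h7q E. [bookkeeping] -/
theorem h7qE : (0:ℚ) ≤ 7 := by norm_num
/-- Auxiliary step `Th7_eqE` (§0): Th7 eq E. [bookkeeping] -/
theorem Th7_eqE : Th7.rep = (Bbox 7 h7qE).rep := rfl

-- [P1 l.8603–8604]
-- ===== END OF COPIED PRELUDE =====

/-! ## §20 (g10)  hEuler — Euler's `ζ(2)` as a KZ-relation by the regular `ϑ`-family

Coordinates of the cell: `X 0 = t`, `X 1 = s` (Stokes direction of the primitive `P̃`), `X 2 = q` (Stokes direction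
of the family `g`).  All integrands are regular on the closed cube; every move is one of the critic-cleared templates
of v14/v13 (`telescope₁`, `rel_sq`, `rel_swap`, `rel_moeb`, `rel_reflect`, `Bq_Bbox`). -/

namespace Euler

/-! ### E1  `[Ax0] ≡ 2•[Q1]`  (`x ↦ x²` in the swapped variable) -/

/-- Auxiliary definition `Q1Den` (§20): Q1 Den. [bookkeeping] -/
def Q1Den : MvPolynomial (Fin 2) ℚ := C 1 + X 0 * X 0 * X 1 * X 1
/-- Auxiliary step `Q1Den_pos` (§20): Q1 Den pos. [bookkeeping] -/
theorem Q1Den_pos (x : Fin 2 → ℝ) : 0 < aeval x Q1Den := by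
  simp only [Q1Den, map_add, map_mul, aeval_C, aeval_X, eq_ratCast, Rat.cast_one]
  nlinarith [mul_self_nonneg (x 0 * x 1)]
/-- `Q1 = [□², st/(1+s²t²)]` (`= π²/48`). -/
def Q1 : RFun 2 := ⟨X 0 * X 1, Q1Den, fun x _ => (Q1Den_pos x).ne'⟩
/-- `Q2 = 2·Q1` pointwise. -/
def Q2 : RFun 2 := ⟨C 2 * X 0 * X 1, Q1Den, fun x _ => (Q1Den_pos x).ne'⟩
/-- Auxiliary definition `AswDen` (§20): Asw Den. [bookkeeping] -/
def AswDen : MvPolynomial (Fin 2) ℚ := C 1 + X 0 * X 1 * X 1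
/-- Auxiliary step `AswDen_pos` (§20): Asw Den pos. [bookkeeping] -/
theorem AswDen_pos {x : Fin 2 → ℝ} (hx : x ∈ KZ.cube 2) : 0 < aeval x AswDen := by
  obtain ⟨h0, h1⟩ := cube2 hx
  simp only [AswDen, map_add, map_mul, aeval_C, aeval_X, eq_ratCast, Rat.cast_one]
  nlinarith [mul_nonneg h0.1 (mul_self_nonneg (x 1))]
/-- `Ax0` with its variables swapped: `y/(1+xy²)`. -/
def Asw : RFun 2 := ⟨X 1, AswDen, fun _ hx => (AswDen_pos hx).ne'⟩

/-- Auxiliary step `Q2_Asw` (§20): Q2 Asw. [bookkeeping] -/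
theorem Q2_Asw : KZ.of Q2.rep - KZ.of Asw.rep ∈ KZ.relations := by
  refine rel_sq Q2 Asw fun z hz => ?_
  simp only [Q2, Asw, Q1Den, AswDen, RFun.fn, map_add, map_sub, map_mul, map_pow, map_neg, aeval_C, aeval_X,
    map_one, map_ofNat, eq_ratCast, Rat.cast_one, Rat.cast_ofNat, Rat.cast_div, Rat.cast_neg, vec2_0, vec2_1,
    Matrix.cons_val_zero, Matrix.cons_val_one, Matrix.head_cons]
  ring
/-- Auxiliary step `Asw_Ax0` (§20): Asw Ax0. [bookkeeping] -/
theorem Asw_Ax0 : KZ.of Asw.rep - KZ.of Ax0.rep ∈ KZ.relations := by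
  refine rel_swap Asw Ax0 fun z hz => ?_
  simp only [Asw, Ax0, AswDen, Ax0Den, RFun.fn, map_add, map_sub, map_mul, map_pow, map_neg, aeval_C, aeval_X,
    map_one, map_ofNat, eq_ratCast, Rat.cast_one, Rat.cast_ofNat, Rat.cast_div, Rat.cast_neg, vec2_0, vec2_1,
    Matrix.cons_val_zero, Matrix.cons_val_one, Matrix.head_cons]
/-- Auxiliary step `Q2_two` (§20): Q2 two. [bookkeeping] -/
theorem Q2_two : KZ.of Q2.rep - 2 • KZ.of Q1.rep ∈ KZ.relations := by
  refine rel_nsmul 2 Q2 Q1 fun z hz => ?_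
  simp only [Q2, Q1, Q1Den, RFun.fn, map_add, map_sub, map_mul, map_pow, map_neg, aeval_C, aeval_X,
    map_one, map_ofNat, eq_ratCast, Rat.cast_one, Rat.cast_ofNat, Rat.cast_div, Rat.cast_neg, Nat.cast_ofNat]
  ring
/-- **E1** `[Ax0] ≡ 2•[Q1]`. -/
theorem Ax0_Q1 : KZ.of Ax0.rep - 2 • KZ.of Q1.rep ∈ KZ.relations := by
  have e : KZ.of Ax0.rep - 2 • KZ.of Q1.rep =
      (KZ.of Q2.rep - 2 • KZ.of Q1.rep) - (KZ.of Q2.rep - KZ.of Asw.rep) - (KZ.of Asw.rep - KZ.of Ax0.rep) := by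
    abel
  rw [e]; exact sub_mem (sub_mem Q2_two Q2_Asw) Asw_Ax0

/-! ### E2  the `ϑ`-family cell: `[U1] − [Q1] ≡ [R1]` -/

/-- the common denominator `(1+q²)·h`, `h = (1+ts)² + q²(1−ts)²`. -/
def D : MvPolynomial (Fin 3) ℚ :=
  (C 1 + X 2 * X 2) * ((C 1 + X 0 * X 1) * (C 1 + X 0 * X 1) + X 2 * X 2 * (C 1 - X 0 * X 1) * (C 1 - X 0 * X 1))
/-- Auxiliary step `D_pos` (§20): D pos. [bookkeeping] -/
theorem D_pos {x : Fin 3 → ℝ} (hx : x ∈ KZ.cube 3) : 0 < aeval x D := by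
  obtain ⟨h0, h1, h2⟩ := cube3 hx
  simp only [map_add, map_sub, map_mul, map_pow, map_neg, aeval_C, aeval_X, map_one, map_ofNat, eq_ratCast,
    Rat.cast_one, Rat.cast_ofNat, Rat.cast_div, Rat.cast_neg, Rat.cast_zero, D]
  have ha : (0:ℝ) < 1 + x 2 * x 2 := by nlinarith [mul_self_nonneg (x 2)]
  have hb : (0:ℝ) < (1 + x 0 * x 1) * (1 + x 0 * x 1) + x 2 * x 2 * (1 - x 0 * x 1) * (1 - x 0 * x 1) := by
    nlinarith [mul_nonneg h0.1 h1.1, mul_self_nonneg (x 2 * (1 - x 0 * x 1))]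
  exact mul_pos ha hb
/-- the family `g = −(1+q²)((1+ts) − q²(1−ts))/D = −((1+ts) − q²(1−ts))/h`. -/
def G : RFun 3 :=
  ⟨-((C 1 + X 2 * X 2) * ((C 1 + X 0 * X 1) - X 2 * X 2 * (C 1 - X 0 * X 1))), D, fun _ hx => (D_pos hx).ne'⟩
/-- the regular primitive `P̃ = 4qs/((1+q²)h)`. -/
def Pt : RFun 3 := ⟨C 4 * X 2 * X 1, D, fun _ hx => (D_pos hx).ne'⟩

set_option maxHeartbeats 1600000 in
/-- Auxiliary step `cert` (§20): cert. [bookkeeping] -/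
theorem cert (x : Fin 3 → ℝ) (hx : x ∈ KZ.cube 3) : (G.pd 2).fn x = (Pt.pd 1).fn x := by
  have hD := (D_pos hx).ne'
  simp +decide only [RFun.fn, RFun.pd, map_add, map_sub, map_mul, map_pow, map_zero, map_neg,
      aeval_C, aeval_X, map_one, eq_ratCast, Rat.cast_one, Rat.cast_ofNat, Rat.cast_div, Rat.cast_neg,
      Derivation.leibniz, pderiv_C, pderiv_X, Pi.single_apply,
      smul_eq_mul, Derivation.map_one_eq_zero, if_true, if_false, mul_one, mul_zero, zero_mul, add_zero,
      zero_add, sub_zero, zero_sub, one_mul, G, Pt, D] at hD ⊢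
  rw [div_eq_div_iff (pow_ne_zero 2 hD) (pow_ne_zero 2 hD)]
  ring

/-- Auxiliary step `tel` (§20): tel. [bookkeeping] -/
theorem tel : bd 2 G - bd 1 Pt ∈ KZ.relations := telescope₁ 2 1 G Pt cert

/-- Auxiliary definition `GtopDen` (§20): Gtop Den. [bookkeeping] -/
def GtopDen : MvPolynomial (Fin 2) ℚ := C 4 + C 4 * X 0 * X 0 * X 1 * X 1
/-- Auxiliary step `GtopDen_pos` (§20): Gtop Den pos. [bookkeeping] -/
theorem GtopDen_pos (x : Fin 2 → ℝ) : 0 < aeval x GtopDen := by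
  simp only [GtopDen, map_add, map_mul, aeval_C, aeval_X, eq_ratCast, Rat.cast_ofNat]
  nlinarith [mul_self_nonneg (x 0 * x 1)]
/-- `g|_{q=1} = −4ts/(4+4t²s²)`. -/
def Gtop : RFun 2 := ⟨-(C 4 * X 0 * X 1), GtopDen, fun x _ => (GtopDen_pos x).ne'⟩
/-- Auxiliary definition `GbotDen` (§20): Gbot Den. [bookkeeping] -/
def GbotDen : MvPolynomial (Fin 2) ℚ := (C 1 + X 0 * X 1) * (C 1 + X 0 * X 1)
/-- Auxiliary step `GbotDen_pos` (§20): Gbot Den pos. [bookkeeping] -/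
theorem GbotDen_pos {x : Fin 2 → ℝ} (hx : x ∈ KZ.cube 2) : 0 < aeval x GbotDen := by
  obtain ⟨h0, h1⟩ := cube2 hx
  simp only [GbotDen, map_add, map_mul, aeval_C, aeval_X, eq_ratCast, Rat.cast_one]
  have : (0:ℝ) < 1 + x 0 * x 1 := by nlinarith [mul_nonneg h0.1 h1.1]
  positivity
/-- `g|_{q=0} = −(1+ts)/(1+ts)²`. -/
def Gbot : RFun 2 := ⟨-(C 1 + X 0 * X 1), GbotDen, fun _ hx => (GbotDen_pos hx).ne'⟩
/-- Auxiliary definition `R1Den` (§20): R1 Den. [bookkeeping] -/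
def R1Den : MvPolynomial (Fin 2) ℚ :=
  (C 1 + X 1 * X 1) * ((C 1 + X 0) * (C 1 + X 0) + X 1 * X 1 * (C 1 - X 0) * (C 1 - X 0))
/-- Auxiliary step `R1Den_pos` (§20): R1 Den pos. [bookkeeping] -/
theorem R1Den_pos {x : Fin 2 → ℝ} (hx : x ∈ KZ.cube 2) : 0 < aeval x R1Den := by
  obtain ⟨h0, h1⟩ := cube2 hx
  simp only [R1Den, map_add, map_sub, map_mul, aeval_C, aeval_X, eq_ratCast, Rat.cast_one]
  have ha : (0:ℝ) < 1 + x 1 * x 1 := by nlinarith [mul_self_nonneg (x 1)]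
  have hb : (0:ℝ) < (1 + x 0) * (1 + x 0) + x 1 * x 1 * (1 - x 0) * (1 - x 0) := by
    nlinarith [mul_self_nonneg (x 1 * (1 - x 0)), h0.1]
  exact mul_pos ha hb
/-- `R1 = P̃|_{s=1} = [□², 4q/((1+q²)((1+t)²+q²(1−t)²))]` (`t = z0`, `q = z1`; `= (π/4)²`). -/
def R1 : RFun 2 := ⟨C 4 * X 1, R1Den, fun _ hx => (R1Den_pos hx).ne'⟩

/-- Auxiliary step `top1` (§20): top1. [bookkeeping] -/
theorem top1 : KZ.of (G.faceAt 2 1 ⟨zero_le_one, le_rfl⟩).rep - KZ.of Gtop.rep ∈ KZ.relations :=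
  RFun.rel_of_eqOn fun x _ => by
    rw [RFun.fn_faceAt]
    simp only [RFun.fn, map_add, map_sub, map_mul, map_pow, map_neg, aeval_C, aeval_X, map_one, map_ofNat,
      eq_ratCast, Rat.cast_one, Rat.cast_ofNat, Rat.cast_div, Rat.cast_neg, Rat.cast_zero, ins1_0, ins1_1, ins1_2,
      ins2_0, ins2_1, ins2_2, G, D, Gtop, GtopDen]
    ring
/-- Auxiliary step `top2` (§20): top2. [bookkeeping] -/
theorem top2 : KZ.of Gtop.rep + KZ.of Q1.rep ∈ KZ.relations :=
  rel_negOf Gtop Q1 fun x hx => by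
    have hA := (GtopDen_pos x).ne'
    have hB := (Q1Den_pos x).ne'
    simp only [RFun.fn, map_add, map_sub, map_mul, map_pow, map_neg, aeval_C, aeval_X, map_one, map_ofNat,
      eq_ratCast, Rat.cast_one, Rat.cast_ofNat, Rat.cast_div, Rat.cast_neg, Rat.cast_zero, Gtop, Q1, GtopDen,
      Q1Den] at hA hB ⊢
    rw [neg_div, neg_inj, div_eq_div_iff hA hB]
    ring
/-- Auxiliary step `bot1` (§20): bot1. [bookkeeping] -/
theorem bot1 : KZ.of (G.faceAt 2 0 ⟨le_rfl, zero_le_one⟩).rep - KZ.of Gbot.rep ∈ KZ.relations :=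
  RFun.rel_of_eqOn fun x _ => by
    rw [RFun.fn_faceAt]
    simp only [RFun.fn, map_add, map_sub, map_mul, map_pow, map_neg, aeval_C, aeval_X, map_one, map_ofNat,
      eq_ratCast, Rat.cast_one, Rat.cast_ofNat, Rat.cast_div, Rat.cast_neg, Rat.cast_zero, ins1_0, ins1_1, ins1_2,
      ins2_0, ins2_1, ins2_2, G, D, Gbot, GbotDen]
    ring
/-- Auxiliary step `bot2` (§20): bot2. [bookkeeping] -/
theorem bot2 : KZ.of Gbot.rep + KZ.of U1.rep ∈ KZ.relations :=
  rel_negOf Gbot U1 fun x hx => by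
    have hA := (GbotDen_pos hx).ne'
    have hB := (QU1_pos hx).ne'
    simp only [RFun.fn, map_add, map_sub, map_mul, map_pow, map_neg, aeval_C, aeval_X, map_one, map_ofNat,
      eq_ratCast, Rat.cast_one, Rat.cast_ofNat, Rat.cast_div, Rat.cast_neg, Rat.cast_zero, Gbot, U1, GbotDen,
      QU1] at hA hB ⊢
    rw [neg_div, neg_inj, div_eq_div_iff hA hB]
    ring
/-- Auxiliary step `right` (§20): right. [bookkeeping] -/
theorem right : KZ.of (Pt.faceAt 1 1 ⟨zero_le_one, le_rfl⟩).rep - KZ.of R1.rep ∈ KZ.relations :=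
  RFun.rel_of_eqOn fun x _ => by
    rw [RFun.fn_faceAt]
    simp only [RFun.fn, map_add, map_sub, map_mul, map_pow, map_neg, aeval_C, aeval_X, map_one, map_ofNat,
      eq_ratCast, Rat.cast_one, Rat.cast_ofNat, Rat.cast_div, Rat.cast_neg, Rat.cast_zero, ins1_0, ins1_1, ins1_2,
      ins2_0, ins2_1, ins2_2, Pt, D, R1, R1Den]
    ring
/-- Auxiliary step `left` (§20): left. [bookkeeping] -/
theorem left : KZ.of (Pt.faceAt 1 0 ⟨le_rfl, zero_le_one⟩).rep ∈ KZ.relations :=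
  RFun.rel_of_eqOn_zero fun x _ => by
    rw [RFun.fn_faceAt]
    simp [RFun.fn, Pt, D, ins1_0, ins1_1, ins1_2]

/-- **the cell**: `[U1] − [Q1] − [R1] ∈ KZ.relations` (`π²/12 − π²/48 = π²/16`). -/
theorem rel : KZ.of U1.rep - KZ.of Q1.rep - KZ.of R1.rep ∈ KZ.relations := by
  have e : KZ.of U1.rep - KZ.of Q1.rep - KZ.of R1.rep =
      (bd 2 G - bd 1 Pt) - (KZ.of (G.faceAt 2 1 ⟨zero_le_one, le_rfl⟩).rep - KZ.of Gtop.rep)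
      - (KZ.of Gtop.rep + KZ.of Q1.rep)
      + (KZ.of (G.faceAt 2 0 ⟨le_rfl, zero_le_one⟩).rep - KZ.of Gbot.rep)
      + (KZ.of Gbot.rep + KZ.of U1.rep)
      + (KZ.of (Pt.faceAt 1 1 ⟨zero_le_one, le_rfl⟩).rep - KZ.of R1.rep)
      - KZ.of (Pt.faceAt 1 0 ⟨le_rfl, zero_le_one⟩).rep := by
    simp only [bd]; abel
  rw [e]
  exact sub_mem (add_mem (add_mem (add_mem (sub_mem (sub_mem tel top1) top2) bot1) bot2) right) left

/-! ### E3  `[R1] ≡ [B11]`: Möbius involution `t = (1−w)/(1+w)`, swap, `Bq_Bbox 1` -/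

/-- Auxiliary definition `Bm1Den` (§20): Bm1 Den. [bookkeeping] -/
def Bm1Den : MvPolynomial (Fin 2) ℚ := (C 1 + X 1 * X 1) * (C 1 + X 1 * X 1 * (C 1 - X 0) * (C 1 - X 0))
/-- Auxiliary step `Bm1Den_pos` (§20): Bm1 Den pos. [bookkeeping] -/
theorem Bm1Den_pos (x : Fin 2 → ℝ) : 0 < aeval x Bm1Den := by
  simp only [Bm1Den, map_add, map_sub, map_mul, aeval_C, aeval_X, eq_ratCast, Rat.cast_one]
  have ha : (0:ℝ) < 1 + x 1 * x 1 := by nlinarith [mul_self_nonneg (x 1)]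
  have hb : (0:ℝ) < 1 + x 1 * x 1 * (1 - x 0) * (1 - x 0) := by nlinarith [mul_self_nonneg (x 1 * (1 - x 0))]
  exact mul_pos ha hb
/-- `2q/((1+q²)(1+q²(1−u)²))` (`u = z0`, `q = z1`). -/
def Bm1 : RFun 2 := ⟨C 2 * X 1, Bm1Den, fun x _ => (Bm1Den_pos x).ne'⟩
/-- Auxiliary definition `BqSDen` (§20): Bq SDen. [bookkeeping] -/
def BqSDen : MvPolynomial (Fin 2) ℚ := (C 1 + X 1 * X 1) * (C 1 + X 1 * X 1 * X 0 * X 0)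
/-- Auxiliary step `BqSDen_pos` (§20): Bq SDen pos. [bookkeeping] -/
theorem BqSDen_pos (x : Fin 2 → ℝ) : 0 < aeval x BqSDen := by
  simp only [BqSDen, map_add, map_sub, map_mul, aeval_C, aeval_X, eq_ratCast, Rat.cast_one]
  have ha : (0:ℝ) < 1 + x 1 * x 1 := by nlinarith [mul_self_nonneg (x 1)]
  have hb : (0:ℝ) < 1 + x 1 * x 1 * x 0 * x 0 := by nlinarith [mul_self_nonneg (x 1 * x 0)]
  exact mul_pos ha hb
/-- `Bq 1` with its variables swapped: `2q/((1+q²)(1+q²w²))` (`w = z0`, `q = z1`). -/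
def BqS : RFun 2 := ⟨C 2 * X 1, BqSDen, fun x _ => (BqSDen_pos x).ne'⟩

end Euler
end Fold
end Summit.KontsevichZagierPeriods.RootDecompQuadraticDescent.Pair18Homotopy
end
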